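import Summits.Ventures.HodgeRepro2.T5SU11KernelCompositionSharpDisc
import Summits.Ventures.HodgeRepro2.T5SU11KernelCompositionSign

/-!
# Summary XXIII — the composed kernels and the powers of the resolvent as analytic functions of the spectral
parameter: Taylor series, the sharp disc, sign and monotonicity (rows 589–592), under uniform names

Throughout `μ = λ(λ − 2)`, `λ(μ) = 1 + √(μ + 1)`, `K_λ` the kernel of `G^I_λ`, `K_λ^{∘(n+1)}(t, s) = (G^I_λ)ⁿ K_λ(·, s)(t)`
the composed kernels, `W_1 = {|g| ≤ D Ξ}`.

* `kernel_comp_analytic_mu`, `kernel_comp_analyticOnNhd`, `kernel_comp_analytic_lam`, `kernel_comp_taylor_series`,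
  `kernel_comp_taylor_hasSum` — **the composed kernels are real-analytic in `μ` on `(−1, ∞)` and in `λ` on `(1, ∞)`, with the
  Taylor series `Σ_k C(n+k, k) (μ − μ₂)^k K_{μ₂}^{∘(n+k+1)}`** (row 589);
* `iterate_iteratedDeriv_mu`, `iterate_analytic_mu`, `iterate_analyticOnNhd`, `iterate_analytic_lam`, `iterate_taylor_series`,
  `iterate_taylor_hasSum` — **the same for the powers `(G^I_μ)^{n+1} g`, `g ∈ W_1`**, with `∂ᵏ_μ (G^I_μ)^{n+1} g = (n+1)⋯(n+k) (G^I_μ)^{n+k+1} g`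
  (row 590);
* `taylor_series_on_ball_of_analytic`, `kernel_comp_power_series_sharp`, `kernel_comp_hasSum_sharp`,
  `iterate_power_series_sharp`, `iterate_hasSum_sharp` — **both Taylor series converge on the sharp disc `|μ − μ₂| < (λ₂ − 1)²`**
  (row 591);
* `kernel_comp_alternating`, `kernel_comp_abs`, `kernel_comp_monotone_mu`, `kernel_comp_monotone_lam`, `kernel_monotone_mu`,
  `kernel_monotone_lam` — **`(−1)^{n+1} K^{∘(n+1)} ≥ 0`; `(−1)ⁿ K^{∘(n+1)}` and the kernel itself increase with `μ` and `λ`** (row 592).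

Nothing is claimed about (N).

Blind lane: Mathlib + the HodgeRepro2 prefix only; no sorry; axioms ⊆ {propext, Classical.choice,
Quot.sound}.
-/

namespace Summit.Ventures.HodgeRepro2.T5SU11RadialSummaryXXIII

open Filter Topology MeasureTheory
open Set (Ioi Ioc Ioo)
open T5SU11Cartan T5SU11SphericalFunction T5SU11SphericalDecay T5SU11RadialGreenKernel T5SU11RadialGreenImproper
  T5SU11KernelCompositionAnalytic T5SU11ResolventIterateAnalytic T5SU11KernelCompositionSharpDisc
  T5SU11KernelCompositionSign

/-- **The abstract sharp-disc step** (row 591): a real function analytic on `(μ₂ − r, μ₂ + r)` whose Taylor series at `μ₂`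
has the coefficients `|c_k| r^k ≤ A C(n+k, k)` has that series on the ball of radius `r`. -/
theorem taylor_series_on_ball_of_analytic {f : ℝ → ℝ} {c : ℕ → ℝ} {μ₂ r A : ℝ} (n : ℕ) (hr : 0 < r)
    (hf : AnalyticOnNhd ℝ f (Ioo (μ₂ - r) (μ₂ + r)))
    (hp : HasFPowerSeriesAt f (FormalMultilinearSeries.ofScalars ℝ c) μ₂)
    (hc : ∀ k, |c k| * r ^ k ≤ A * ((n + k).choose k : ℝ)) :
    HasFPowerSeriesOnBall f (FormalMultilinearSeries.ofScalars ℝ c) μ₂ (ENNReal.ofReal r) :=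
  hasFPowerSeriesOnBall_of_analyticOnNhd n hr hf hp hc

section measure

variable [MeasurableSpace Circle] [BorelSpace Circle]

section kernel

variable {s : ℝ} (hs : 0 < s)

include hs in
/-- **The composed kernels are real-analytic in `μ`** at every `μ₂ > −1` (row 589). -/
theorem kernel_comp_analytic_mu (n : ℕ) {μ₂ : ℝ} (hμ₂ : -1 < μ₂) {t : ℝ} (ht : 0 < t) :
    AnalyticAt ℝ (fun μ => ((greenSolI (fun t => sph (1 + Real.sqrt (μ + 1)) (hyp t))
      (sphDecay (1 + Real.sqrt (μ + 1))))^[n] (fun r => sphGreenKernel (1 + Real.sqrt (μ + 1)) r s)) t) μ₂ :=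
  kernel_comp_analyticAt_mu hs n hμ₂ ht

include hs in
/-- The composed kernels are real-analytic in `μ` on `(−1, ∞)` (row 589). -/
theorem kernel_comp_analyticOnNhd (n : ℕ) {t : ℝ} (ht : 0 < t) :
    AnalyticOnNhd ℝ (fun μ => ((greenSolI (fun t => sph (1 + Real.sqrt (μ + 1)) (hyp t))
      (sphDecay (1 + Real.sqrt (μ + 1))))^[n] (fun r => sphGreenKernel (1 + Real.sqrt (μ + 1)) r s)) t) (Ioi (-1)) :=
  kernel_comp_analyticOnNhd_mu hs n ht

include hs in
/-- **The composed kernels are real-analytic in `λ`** at every `λ₂ > 1` (row 589). -/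
theorem kernel_comp_analytic_lam (n : ℕ) {lam₂ : ℝ} (hlam₂ : 1 < lam₂) {t : ℝ} (ht : 0 < t) :
    AnalyticAt ℝ (fun lam => ((greenSolI (fun t => sph lam (hyp t)) (sphDecay lam))^[n]
      (fun r => sphGreenKernel lam r s)) t) lam₂ :=
  kernel_comp_analyticAt_lam hs n hlam₂ ht

include hs in
/-- **The Taylor series of the composed kernels** `Σ_k C(n+k, k) K_{μ₂}^{∘(n+k+1)}(t, s) (μ − μ₂)^k` (row 589). -/
theorem kernel_comp_taylor_series (n : ℕ) {μ₂ : ℝ} (hμ₂ : -1 < μ₂) {t : ℝ} (ht : 0 < t) :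
    HasFPowerSeriesAt (fun μ => ((greenSolI (fun t => sph (1 + Real.sqrt (μ + 1)) (hyp t))
        (sphDecay (1 + Real.sqrt (μ + 1))))^[n] (fun r => sphGreenKernel (1 + Real.sqrt (μ + 1)) r s)) t)
      (FormalMultilinearSeries.ofScalars ℝ (fun k => ((n + k).choose k : ℝ)
        * ((greenSolI (fun t => sph (1 + Real.sqrt (μ₂ + 1)) (hyp t))
          (sphDecay (1 + Real.sqrt (μ₂ + 1))))^[n + k] (fun r => sphGreenKernel (1 + Real.sqrt (μ₂ + 1)) r s)) t))
      μ₂ :=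
  kernel_comp_hasFPowerSeriesAt hs n hμ₂ ht

include hs in
/-- The composed kernels are the sums of their Taylor series near every `μ₂ > −1` (row 589). -/
theorem kernel_comp_taylor_hasSum (n : ℕ) {μ₂ : ℝ} (hμ₂ : -1 < μ₂) {t : ℝ} (ht : 0 < t) :
    ∀ᶠ y : ℝ in 𝓝 0, HasSum (fun k : ℕ => ((n + k).choose k : ℝ)
        * ((greenSolI (fun t => sph (1 + Real.sqrt (μ₂ + 1)) (hyp t))
          (sphDecay (1 + Real.sqrt (μ₂ + 1))))^[n + k] (fun r => sphGreenKernel (1 + Real.sqrt (μ₂ + 1)) r s)) t * y ^ k)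
      (((greenSolI (fun t => sph (1 + Real.sqrt (μ₂ + y + 1)) (hyp t))
        (sphDecay (1 + Real.sqrt (μ₂ + y + 1))))^[n] (fun r => sphGreenKernel (1 + Real.sqrt (μ₂ + y + 1)) r s)) t) :=
  kernel_comp_eventually_hasSum hs n hμ₂ ht

include hs in
/-- **The Taylor series of the composed kernels on the sharp disc** (row 591): the power series of radius `(λ₂ − 1)²`
about `μ₂ = λ₂(λ₂ − 2)`. -/
theorem kernel_comp_power_series_sharp {lam₂ : ℝ} (hlam₂ : 1 < lam₂) (n : ℕ) {t : ℝ} (ht : 0 < t) :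
    HasFPowerSeriesOnBall (fun μ => ((greenSolI (fun t => sph (1 + Real.sqrt (μ + 1)) (hyp t))
        (sphDecay (1 + Real.sqrt (μ + 1))))^[n] (fun r => sphGreenKernel (1 + Real.sqrt (μ + 1)) r s)) t)
      (FormalMultilinearSeries.ofScalars ℝ (fun k => ((n + k).choose k : ℝ)
        * ((greenSolI (fun t => sph lam₂ (hyp t)) (sphDecay lam₂))^[n + k] (fun r => sphGreenKernel lam₂ r s)) t))
      (lam₂ * (lam₂ - 2)) (ENNReal.ofReal ((lam₂ - 1) ^ 2)) :=
  kernel_comp_hasFPowerSeriesOnBall hlam₂ hs n ht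

include hs in
/-- **`K_λ^{∘(n+1)}(t, s) = Σ_k (μ − μ₂)^k C(n+k, k) K_{λ₂}^{∘(n+k+1)}(t, s)` on the sharp disc** (row 591). -/
theorem kernel_comp_hasSum_sharp {lam lam₂ : ℝ} (hlam : 1 < lam) (hlam₂ : 1 < lam₂)
    (hq : |lam * (lam - 2) - lam₂ * (lam₂ - 2)| < (lam₂ - 1) ^ 2) (n : ℕ) {t : ℝ} (ht : 0 < t) :
    HasSum (fun k : ℕ => (lam * (lam - 2) - lam₂ * (lam₂ - 2)) ^ k * (((n + k).choose k : ℝ)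
        * ((greenSolI (fun t => sph lam₂ (hyp t)) (sphDecay lam₂))^[n + k] (fun r => sphGreenKernel lam₂ r s)) t))
      (((greenSolI (fun t => sph lam (hyp t)) (sphDecay lam))^[n] (fun r => sphGreenKernel lam r s)) t) :=
  kernel_comp_hasSum hlam₂ hs hlam hq n ht

/-- **The composed kernels alternate in sign**: `(−1)^{n+1} K_λ^{∘(n+1)}(t, s) ≥ 0` (row 592). -/
theorem kernel_comp_alternating {lam : ℝ} (hlam : 1 < lam) (n : ℕ) {t : ℝ} (ht : 0 < t) :
    0 ≤ (-1 : ℝ) ^ (n + 1)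
      * ((greenSolI (fun t => sph lam (hyp t)) (sphDecay lam))^[n] (fun r => sphGreenKernel lam r s)) t :=
  kernel_comp_sign (s := s) hlam n ht

/-- `|K_λ^{∘(n+1)}(t, s)| = (−1)^{n+1} K_λ^{∘(n+1)}(t, s)` (row 592). -/
theorem kernel_comp_abs {lam : ℝ} (hlam : 1 < lam) (n : ℕ) {t : ℝ} (ht : 0 < t) :
    |((greenSolI (fun t => sph lam (hyp t)) (sphDecay lam))^[n] (fun r => sphGreenKernel lam r s)) t|
      = (-1 : ℝ) ^ (n + 1)
        * ((greenSolI (fun t => sph lam (hyp t)) (sphDecay lam))^[n] (fun r => sphGreenKernel lam r s)) t :=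
  abs_kernel_comp_eq (s := s) hlam n ht

include hs in
/-- **`(−1)ⁿ K_μ^{∘(n+1)}(t, s)` increases with `μ`** on `(−1, ∞)` (row 592). -/
theorem kernel_comp_monotone_mu (n : ℕ) {t : ℝ} (ht : 0 < t) :
    MonotoneOn (fun μ => (-1 : ℝ) ^ n * ((greenSolI (fun t => sph (1 + Real.sqrt (μ + 1)) (hyp t))
      (sphDecay (1 + Real.sqrt (μ + 1))))^[n] (fun r => sphGreenKernel (1 + Real.sqrt (μ + 1)) r s)) t) (Ioi (-1)) :=
  kernel_comp_sign_monotoneOn_mu hs n ht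

include hs in
/-- **`(−1)ⁿ K_λ^{∘(n+1)}(t, s)` increases with `λ`** on `(1, ∞)` (row 592). -/
theorem kernel_comp_monotone_lam (n : ℕ) {t : ℝ} (ht : 0 < t) :
    MonotoneOn (fun lam => (-1 : ℝ) ^ n * ((greenSolI (fun t => sph lam (hyp t)) (sphDecay lam))^[n]
      (fun r => sphGreenKernel lam r s)) t) (Ioi 1) :=
  kernel_comp_sign_monotoneOn_lam hs n ht

include hs in
/-- **The kernel increases with `μ`** on `(−1, ∞)` (row 592). -/
theorem kernel_monotone_mu {t : ℝ} (ht : 0 < t) :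
    MonotoneOn (fun μ => sphGreenKernel (1 + Real.sqrt (μ + 1)) t s) (Ioi (-1)) :=
  kernel_monotoneOn_mu hs ht

include hs in
/-- **The kernel increases with `λ`** on `(1, ∞)` (row 592). -/
theorem kernel_monotone_lam {t : ℝ} (ht : 0 < t) :
    MonotoneOn (fun lam => sphGreenKernel lam t s) (Ioi 1) :=
  kernel_monotoneOn_lam hs ht

end kernel

section ground_state

variable {g : ℝ → ℝ} (hg : ContinuousOn g (Ioi 0)) {D : ℝ} (hD : ∀ s, 0 < s → |g s| ≤ D * sph 1 (hyp s))

include hg hD in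
/-- **The iterated derivatives of the powers of the resolvent** `∂ᵏ_μ (G^I_μ)^{n+1} g = (n+1)⋯(n+k) (G^I_μ)^{n+k+1} g` (row 590). -/
theorem iterate_iteratedDeriv_mu (k n : ℕ) {μ₂ : ℝ} (hμ₂ : -1 < μ₂) {t : ℝ} (ht : 0 < t) :
    iteratedDeriv k (fun μ => ((greenSolI (fun t => sph (1 + Real.sqrt (μ + 1)) (hyp t))
        (sphDecay (1 + Real.sqrt (μ + 1))))^[n + 1] g) t) μ₂
      = ((n + k).descFactorial k : ℝ) * ((greenSolI (fun t => sph (1 + Real.sqrt (μ₂ + 1)) (hyp t))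
        (sphDecay (1 + Real.sqrt (μ₂ + 1))))^[n + k + 1] g) t :=
  iteratedDeriv_iterate_mu hg hD k n hμ₂ ht

include hg hD in
/-- **The powers of the resolvent are real-analytic in `μ`** at every `μ₂ > −1` (row 590). -/
theorem iterate_analytic_mu (n : ℕ) {μ₂ : ℝ} (hμ₂ : -1 < μ₂) {t : ℝ} (ht : 0 < t) :
    AnalyticAt ℝ (fun μ => ((greenSolI (fun t => sph (1 + Real.sqrt (μ + 1)) (hyp t))
      (sphDecay (1 + Real.sqrt (μ + 1))))^[n + 1] g) t) μ₂ :=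
  iterate_analyticAt_mu hg hD n hμ₂ ht

include hg hD in
/-- The powers of the resolvent are real-analytic in `μ` on `(−1, ∞)` (row 590). -/
theorem iterate_analyticOnNhd (n : ℕ) {t : ℝ} (ht : 0 < t) :
    AnalyticOnNhd ℝ (fun μ => ((greenSolI (fun t => sph (1 + Real.sqrt (μ + 1)) (hyp t))
      (sphDecay (1 + Real.sqrt (μ + 1))))^[n + 1] g) t) (Ioi (-1)) :=
  iterate_analyticOnNhd_mu hg hD n ht

include hg hD in
/-- **The powers of the resolvent are real-analytic in `λ`** at every `λ₂ > 1` (row 590). -/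
theorem iterate_analytic_lam (n : ℕ) {lam₂ : ℝ} (hlam₂ : 1 < lam₂) {t : ℝ} (ht : 0 < t) :
    AnalyticAt ℝ (fun lam => ((greenSolI (fun t => sph lam (hyp t)) (sphDecay lam))^[n + 1] g) t) lam₂ :=
  iterate_analyticAt_lam hg hD n hlam₂ ht

include hg hD in
/-- **The Taylor series of the powers of the resolvent** `Σ_k C(n+k, k) (G^I_{μ₂})^{n+k+1} g(t) (μ − μ₂)^k` (row 590). -/
theorem iterate_taylor_series (n : ℕ) {μ₂ : ℝ} (hμ₂ : -1 < μ₂) {t : ℝ} (ht : 0 < t) :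
    HasFPowerSeriesAt (fun μ => ((greenSolI (fun t => sph (1 + Real.sqrt (μ + 1)) (hyp t))
        (sphDecay (1 + Real.sqrt (μ + 1))))^[n + 1] g) t)
      (FormalMultilinearSeries.ofScalars ℝ (fun k => ((n + k).choose k : ℝ)
        * ((greenSolI (fun t => sph (1 + Real.sqrt (μ₂ + 1)) (hyp t))
          (sphDecay (1 + Real.sqrt (μ₂ + 1))))^[n + k + 1] g) t))
      μ₂ :=
  iterate_hasFPowerSeriesAt hg hD n hμ₂ ht

include hg hD in
/-- The powers of the resolvent are the sums of their Taylor series near every `μ₂ > −1` (row 590). -/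
theorem iterate_taylor_hasSum (n : ℕ) {μ₂ : ℝ} (hμ₂ : -1 < μ₂) {t : ℝ} (ht : 0 < t) :
    ∀ᶠ y : ℝ in 𝓝 0, HasSum (fun k : ℕ => ((n + k).choose k : ℝ)
        * ((greenSolI (fun t => sph (1 + Real.sqrt (μ₂ + 1)) (hyp t))
          (sphDecay (1 + Real.sqrt (μ₂ + 1))))^[n + k + 1] g) t * y ^ k)
      (((greenSolI (fun t => sph (1 + Real.sqrt (μ₂ + y + 1)) (hyp t))
        (sphDecay (1 + Real.sqrt (μ₂ + y + 1))))^[n + 1] g) t) :=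
  iterate_eventually_hasSum hg hD n hμ₂ ht

include hg hD in
/-- **The Taylor series of the powers of the resolvent on the sharp disc** (row 591). -/
theorem iterate_power_series_sharp {lam₂ : ℝ} (hlam₂ : 1 < lam₂) (n : ℕ) {t : ℝ} (ht : 0 < t) :
    HasFPowerSeriesOnBall (fun μ => ((greenSolI (fun t => sph (1 + Real.sqrt (μ + 1)) (hyp t))
        (sphDecay (1 + Real.sqrt (μ + 1))))^[n + 1] g) t)
      (FormalMultilinearSeries.ofScalars ℝ (fun k => ((n + k).choose k : ℝ)
        * ((greenSolI (fun t => sph lam₂ (hyp t)) (sphDecay lam₂))^[n + k + 1] g) t))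
      (lam₂ * (lam₂ - 2)) (ENNReal.ofReal ((lam₂ - 1) ^ 2)) :=
  iterate_hasFPowerSeriesOnBall hlam₂ hg hD n ht

include hg hD in
/-- **`(G^I_λ)^{n+1} g(t) = Σ_k (μ − μ₂)^k C(n+k, k) (G^I_{λ₂})^{n+k+1} g(t)` on the sharp disc** (row 591). -/
theorem iterate_hasSum_sharp {lam lam₂ : ℝ} (hlam : 1 < lam) (hlam₂ : 1 < lam₂)
    (hq : |lam * (lam - 2) - lam₂ * (lam₂ - 2)| < (lam₂ - 1) ^ 2) (n : ℕ) {t : ℝ} (ht : 0 < t) :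
    HasSum (fun k : ℕ => (lam * (lam - 2) - lam₂ * (lam₂ - 2)) ^ k * (((n + k).choose k : ℝ)
        * ((greenSolI (fun t => sph lam₂ (hyp t)) (sphDecay lam₂))^[n + k + 1] g) t))
      (((greenSolI (fun t => sph lam (hyp t)) (sphDecay lam))^[n + 1] g) t) :=
  iterate_hasSum hlam₂ hg hD hlam hq n ht

end ground_state

end measure

end Summit.Ventures.HodgeRepro2.T5SU11RadialSummaryXXIII
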